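import Summits.Schanuel.Schanuel.Theorems.ZilberEacAlgebraicBranch
import Summits.Schanuel.Schanuel.Theorems.ZilberEacBoundedBranchExamples
import Summits.Schanuel.Schanuel.Theorems.ZilberEacPlaneCurveEdgePlaces
import Summits.Schanuel.Schanuel.Theorems.ZilberEacPlaneCurveNotLine
import HarnessLib

/-!
# Arbitrary base branches, LXXXIV: MANTOVA–MASSER'S DENSITY QUESTION HAS ANSWER YES FOR EVERY
# POLYNOMIAL FIBRE OVER EVERY IRREDUCIBLE PLANE CURVE DEFINED OVER `ℚ̄`

HONEST FRAMING.  Cell `pub-schanuel` (Zilber's Exponential-Algebraic Closedness, case ladder;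
host summit Schanuel), seat 2, gen 32.  Mantova–Masser (PLMS 2024, §1 p. 5) ask whether the
exponential points of a surface `W ⊆ ℂ² × (ℂˣ)²` of their case (irreducible, `dim π_add(W) = 1`, on
no vertical line, additively free) are Zariski dense in `W`.  This file answers YES for all
`W = {F(x₀, x₁) = 0, y₀ = R(x₀, x₁)}` with `F ∈ ℚ̄[x₀, x₁]` irreducible of `x₁`-degree `≥ 2` and ANY
`R ∈ ℂ[x₀, x₁]` not vanishing on the curve:
**`unprojectedDensityQuestion_planeCurve_polyFibre_algebraic`**.  Proof: if some row `f_j`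
(`j < n`) is longer than the leading row `f_n`, the curve has an unbounded place over `x₀ = ∞`
(file LXV) whose direction is algebraic (file LXXXI), and file LXXXIII decides every fibre value
along it (growth / THEOREM I / Kronecker / transport, resonance being excluded by Lindemann, file
LXXXII; fast-regime pole fibres by file LXXX(c)); otherwise the top row at the level of the
leading row has the root giving a BOUNDED place, and file LXVII (resultant elimination +
THEOREM T) decides every fibre.  The only surfaces of this shape NOT covered are those whose curve
needs a transcendental coefficient (the known non-dense cylinder `{x₁ = x₀²/(2πi), y₀ = 1}` is of
this kind, and of `x₁`-degree `1`).  What this is NOT: fibres depending on `y₁`, fibre CURVES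
`P(x, y₀) = 0` of `y₀`-degree `≥ 2` over general curves, Fib(3,2), EC(3,2) — all OPEN; NOT
Schanuel's conjecture (neither used nor implied; Lindemann's theorem is used); EAC ⇏ SC.
-/

noncomputable section

open Filter Topology Set Complex Polynomial
open Literature.NumberTheory.Transcendental Literature.ModelTheory.Zilber
open Literature.ModelTheory.ExponentialFields

set_option linter.dupNamespace false

namespace Summit.Schanuel.Schanuel.Theorems

section AlgebraicCurves

variable (F : ℂ[X][X])

/-- **Mantova–Masser's density question over every plane curve defined over `ℚ̄` that is not a
line: case ∧ dense for every polynomial fibre.**  `F ∈ ℂ[x₀][x₁]` irreducible of `x₁`-degree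
`n ≥ 1` — and if `n = 1` then its leading row is non-constant or its constant row has degree `≥ 2`
(i.e. the curve is not a line) — with all coefficients algebraic over `ℚ`; `R ∈ ℂ[x₀, x₁]` nonzero
somewhere on the curve.  Then `{F = 0, y₀ = R(x₀, x₁)}` is in Mantova–Masser's case AND its
exponential points are Zariski dense.
[cite: MantovaMasser2023, §1 Further remarks, p. 5 (the question, open in general)] (new) -/
theorem unprojectedDensityQuestion_planeCurve_polyFibre_algebraic_of_notLine (hFirr : Irreducible F)
    (hF1 : 1 ≤ F.natDegree)
    (hnl : F.natDegree = 1 → 1 ≤ F.leadingCoeff.natDegree ∨ 2 ≤ (F.coeff 0).natDegree)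
    (halg : ∀ i j, IsAlgebraic ℚ ((F.coeff j).coeff i))
    (R : MvPolynomial (Fin 2) ℂ)
    (hR : ∃ x y : ℂ, (F.map (Polynomial.evalRingHom x)).eval y = 0 ∧ MvPolynomial.eval ![x, y] R ≠ 0) :
    MMCaseDimPiOneFree {w : Fin 2 ⊕ Fin 2 → ℂ |
        (F.map (Polynomial.evalRingHom (w (Sum.inl 0)))).eval (w (Sum.inl 1)) = 0 ∧
        w (Sum.inr 0) = MvPolynomial.eval ![w (Sum.inl 0), w (Sum.inl 1)] R} ∧
      UnprojectedDense {w : Fin 2 ⊕ Fin 2 → ℂ |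
        (F.map (Polynomial.evalRingHom (w (Sum.inl 0)))).eval (w (Sum.inl 1)) = 0 ∧
        w (Sum.inr 0) = MvPolynomial.eval ![w (Sum.inl 0), w (Sum.inl 1)] R} := by
  classical
  have hnc := planeCurve_not_contains_line_of_notLine F hFirr hF1 hnl
  by_cases hlong : ∃ j, j < F.natDegree ∧ F.leadingCoeff.natDegree < (F.coeff j).natDegree
  · -- an unbounded place over `x₀ = ∞` with algebraic direction
    refine ⟨mmCase_planeCurve_polyFibre_of_notLine F hFirr hF1 hnl R hR, ?_⟩
    obtain ⟨k, M, Φ, hk, hM, hΦan, hΦ0, hplace⟩ :=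
      exists_place_atInfinity_of_longRow F hFirr hF1 hlong
    obtain ⟨Φr, hΦr⟩ := exists_rowsEquiv
    set A : MvPolynomial (Fin 2) ℂ := Φr.symm F with hA
    have hPQ : ∀ x y : ℂ, MvPolynomial.eval ![x, y] A =
        (F.map (Polynomial.evalRingHom x)).eval y := by
      intro x y
      rw [hΦr, hA, RingEquiv.apply_symm_apply]
    have hirrA : Irreducible A := (irreducible_rows_iff hPQ).2 hFirr
    have hset : {w : Fin 2 ⊕ Fin 2 → ℂ |
        (F.map (Polynomial.evalRingHom (w (Sum.inl 0)))).eval (w (Sum.inl 1)) = 0 ∧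
        w (Sum.inr 0) = MvPolynomial.eval ![w (Sum.inl 0), w (Sum.inl 1)] R} =
        {w : Fin 2 ⊕ Fin 2 → ℂ | MvPolynomial.eval ![w (Sum.inl 0), w (Sum.inl 1)] A = 0 ∧
          w (Sum.inr 0) = MvPolynomial.eval ![w (Sum.inl 0), w (Sum.inl 1)] R} := by
      ext w
      simp only [Set.mem_setOf_eq, hPQ]
    rw [hset]
    have hS := isIrreducibleClosed_curveGraphFibre R hirrA
    have hdim := zariskiDim_curveGraphFibre R hirrA
    have hndvd : ¬ F ∣ Φr R := by
      refine not_dvd_of_exists_eval_ne_zero F ?_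
      obtain ⟨x, y, hxy, hne⟩ := hR
      exact ⟨x, y, hxy, by rw [← hΦr]; exact hne⟩
    obtain ⟨ψ, L, hψan, hψ0, hf⟩ :=
      exists_rows_place_normalForm F hFirr hF1 (Φr R) hndvd hk M hΦan hplace
    refine unprojectedDense_branch_of_algebraicCurve F hS (le_of_eq hdim) hFirr hnc halg hk hM hΦan
      hΦ0 hplace L hψan hψ0 ?_
    filter_upwards [hplace, hf] with s hs hfs
    refine ⟨?_, ?_⟩
    · simp only [Sum.elim_inl, Matrix.cons_val_zero, Matrix.cons_val_one]
      rw [hPQ]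
      exact hs
    · simp only [Sum.elim_inr, Sum.elim_inl, Matrix.cons_val_zero, Matrix.cons_val_one]
      rw [hΦr, hfs]
  · push Not at hlong
    by_cases hn : 2 ≤ F.natDegree
    · -- no long row: the top row at the level of the leading row gives a bounded place (file LXVII)
      refine unprojectedDensityQuestion_planeCurve_polyFibre_of_topRow F hFirr hn
        F.leadingCoeff.natDegree (fun j => ?_) ⟨F.natDegree, by omega, ?_⟩ R hR
      · by_cases hj : j < F.natDegree
        · exact hlong j hj
        · by_cases hj' : j = F.natDegree
          · rw [hj']
            exact le_rfl
          · rw [Polynomial.coeff_eq_zero_of_natDegree_lt (by omega), Polynomial.natDegree_zero]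
            exact Nat.zero_le _
      · exact Polynomial.leadingCoeff_ne_zero.2 (Polynomial.leadingCoeff_ne_zero.2 hFirr.ne_zero)
    · -- `x₁`-degree one without a long row: a bounded rational graph (file LXX)
      have h1 : F.natDegree = 1 := by omega
      have hlc : F.leadingCoeff = F.coeff 1 := by rw [Polynomial.leadingCoeff, h1]
      have hFeq : F = Polynomial.C (F.coeff 1) * Polynomial.X + Polynomial.C (F.coeff 0) :=
        Polynomial.eq_X_add_C_of_natDegree_le_one (le_of_eq h1)
      have hdeg : (F.coeff 0).natDegree ≤ (F.coeff 1).natDegree := by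
        rw [← hlc]
        exact hlong 0 (by omega)
      have hα : 1 ≤ (F.coeff 1).natDegree := by
        rcases hnl h1 with h | h
        · rwa [hlc] at h
        · omega
      have hirr' : Irreducible
          (Polynomial.C (F.coeff 1) * Polynomial.X + Polynomial.C (F.coeff 0) : ℂ[X][X]) := by
        rw [← hFeq]; exact hFirr
      have h := unprojectedDensityQuestion_rationalGraph_polyFibre (F.coeff 1) (F.coeff 0) hirr' hα
        hdeg R (by
          obtain ⟨x, y, hxy, hne⟩ := hR
          exact ⟨x, y, by rw [← hFeq]; exact hxy, hne⟩)
      rw [← hFeq] at h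
      exact h

/-- **`x₁`-degree `≥ 2`** (the headline form): for every irreducible `F ∈ ℚ̄[x₀][x₁]` of
`x₁`-degree `≥ 2` and every `R` nonzero somewhere on the curve, `{F = 0, y₀ = R(x₀, x₁)}` is in
Mantova–Masser's case AND dense. [cite: MantovaMasser2023, §1 Further remarks, p. 5 (the
question, open in general)] (new) -/
theorem unprojectedDensityQuestion_planeCurve_polyFibre_algebraic (hFirr : Irreducible F)
    (hn : 2 ≤ F.natDegree) (halg : ∀ i j, IsAlgebraic ℚ ((F.coeff j).coeff i))
    (R : MvPolynomial (Fin 2) ℂ)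
    (hR : ∃ x y : ℂ, (F.map (Polynomial.evalRingHom x)).eval y = 0 ∧ MvPolynomial.eval ![x, y] R ≠ 0) :
    MMCaseDimPiOneFree {w : Fin 2 ⊕ Fin 2 → ℂ |
        (F.map (Polynomial.evalRingHom (w (Sum.inl 0)))).eval (w (Sum.inl 1)) = 0 ∧
        w (Sum.inr 0) = MvPolynomial.eval ![w (Sum.inl 0), w (Sum.inl 1)] R} ∧
      UnprojectedDense {w : Fin 2 ⊕ Fin 2 → ℂ |
        (F.map (Polynomial.evalRingHom (w (Sum.inl 0)))).eval (w (Sum.inl 1)) = 0 ∧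
        w (Sum.inr 0) = MvPolynomial.eval ![w (Sum.inl 0), w (Sum.inl 1)] R} :=
  unprojectedDensityQuestion_planeCurve_polyFibre_algebraic_of_notLine F hFirr (by omega)
    (notLine_of_two_le F hn) halg R hR

/-- **Unbounded rational graphs over `ℚ̄`** — the `x₁`-degree-one case spelled out:
`a(x₀)x₁ + b(x₀)` irreducible with `a, b ∈ ℚ̄[x]`, `deg a ≥ 1` (bounded or not): every polynomial
fibre is in the case AND dense (bounded graphs: gen 31 file LXX for all fibres; unbounded: new).
[cite: MantovaMasser2023, §1 Further remarks, p. 5 (the question, open in general)] (new) -/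
theorem unprojectedDensityQuestion_rationalGraph_polyFibre_algebraic (a b : ℂ[X])
    (hirr : Irreducible (Polynomial.C a * Polynomial.X + Polynomial.C b : ℂ[X][X]))
    (ha : 1 ≤ a.natDegree) (halga : ∀ i, IsAlgebraic ℚ (a.coeff i))
    (halgb : ∀ i, IsAlgebraic ℚ (b.coeff i)) (R : MvPolynomial (Fin 2) ℂ)
    (hR : ∃ x y : ℂ, a.eval x * y + b.eval x = 0 ∧ MvPolynomial.eval ![x, y] R ≠ 0) :
    MMCaseDimPiOneFree {w : Fin 2 ⊕ Fin 2 → ℂ |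
        a.eval (w (Sum.inl 0)) * w (Sum.inl 1) + b.eval (w (Sum.inl 0)) = 0 ∧
        w (Sum.inr 0) = MvPolynomial.eval ![w (Sum.inl 0), w (Sum.inl 1)] R} ∧
      UnprojectedDense {w : Fin 2 ⊕ Fin 2 → ℂ |
        a.eval (w (Sum.inl 0)) * w (Sum.inl 1) + b.eval (w (Sum.inl 0)) = 0 ∧
        w (Sum.inr 0) = MvPolynomial.eval ![w (Sum.inl 0), w (Sum.inl 1)] R} := by
  classical
  have ha0 : a ≠ 0 := by
    rintro rfl; rw [Polynomial.natDegree_zero] at ha; exact Nat.not_succ_le_zero 0 ha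
  have hdeg1 := natDegree_rationalGraph a b ha0
  have hc1 : (Polynomial.C a * Polynomial.X + Polynomial.C b : ℂ[X][X]).coeff 1 = a := by simp
  have hc0 : (Polynomial.C a * Polynomial.X + Polynomial.C b : ℂ[X][X]).coeff 0 = b := by simp
  have h := unprojectedDensityQuestion_planeCurve_polyFibre_algebraic_of_notLine
    (Polynomial.C a * Polynomial.X + Polynomial.C b) hirr (by omega)
    (fun _ => Or.inl (by rw [Polynomial.leadingCoeff, hdeg1, hc1]; exact ha)) (fun i j => ?_) R
    (by simpa only [eval_rationalGraph] using hR)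
  · simpa only [eval_rationalGraph] using h
  · rcases j with _ | _ | j
    · rw [hc0]; exact halgb i
    · rw [hc1]; exact halga i
    · have h0 : (Polynomial.C a * Polynomial.X + Polynomial.C b : ℂ[X][X]).coeff (j + 2) = 0 :=
        Polynomial.coeff_eq_zero_of_natDegree_lt (by rw [hdeg1]; omega)
      rw [h0, Polynomial.coeff_zero]
      exact isAlgebraic_zero

/-- **Rational coefficients** (the most common case): `F ∈ ℚ[x₀, x₁]` given through a coefficient
function `c : ℕ → ℕ → ℚ` with `[x₀^i x₁^j]F = c i j`. [cite: MantovaMasser2023, §1 Further remarks,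
p. 5 (the question, open in general)] (new) -/
theorem unprojectedDensityQuestion_planeCurve_polyFibre_rational (hFirr : Irreducible F)
    (hn : 2 ≤ F.natDegree) (c : ℕ → ℕ → ℚ) (hc : ∀ i j, (F.coeff j).coeff i = (c i j : ℂ))
    (R : MvPolynomial (Fin 2) ℂ)
    (hR : ∃ x y : ℂ, (F.map (Polynomial.evalRingHom x)).eval y = 0 ∧ MvPolynomial.eval ![x, y] R ≠ 0) :
    MMCaseDimPiOneFree {w : Fin 2 ⊕ Fin 2 → ℂ |
        (F.map (Polynomial.evalRingHom (w (Sum.inl 0)))).eval (w (Sum.inl 1)) = 0 ∧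
        w (Sum.inr 0) = MvPolynomial.eval ![w (Sum.inl 0), w (Sum.inl 1)] R} ∧
      UnprojectedDense {w : Fin 2 ⊕ Fin 2 → ℂ |
        (F.map (Polynomial.evalRingHom (w (Sum.inl 0)))).eval (w (Sum.inl 1)) = 0 ∧
        w (Sum.inr 0) = MvPolynomial.eval ![w (Sum.inl 0), w (Sum.inl 1)] R} :=
  unprojectedDensityQuestion_planeCurve_polyFibre_algebraic F hFirr hn
    (fun i j => by rw [hc]; exact isAlgebraic_algebraMap (c i j)) R hR

/-- **Rational fibres over every plane curve defined over `ℚ̄`** (`S`-form).  `F` irreducible of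
`x₁`-degree `≥ 2` with algebraic coefficients; `R, Q ∈ ℂ[x₀, x₁]` nonzero somewhere on the curve;
`S` irreducible closed of dimension `≤ 2` containing `(x, R(x)/Q(x), e^{x₁})` for every `x` on the
curve with `Q(x) ≠ 0`.  Then `S` has Zariski-dense exponential points.
[cite: MantovaMasser2023, §1 Further remarks, p. 5 (the question, open in general)] (new) -/
theorem unprojectedDense_planeCurve_rationalFibre_algebraic (hFirr : Irreducible F)
    (hn : 2 ≤ F.natDegree) (halg : ∀ i j, IsAlgebraic ℚ ((F.coeff j).coeff i))
    (R Q : MvPolynomial (Fin 2) ℂ)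
    (hR : ∃ x y : ℂ, (F.map (Polynomial.evalRingHom x)).eval y = 0 ∧ MvPolynomial.eval ![x, y] R ≠ 0)
    (hQ : ∃ x y : ℂ, (F.map (Polynomial.evalRingHom x)).eval y = 0 ∧ MvPolynomial.eval ![x, y] Q ≠ 0)
    {S : Set (Fin 2 ⊕ Fin 2 → ℂ)} (hS : IsIrreducibleClosed ℂ S) (hdim : zariskiDim ℂ S ≤ (2 : ℕ))
    (hsub : ∀ x y : ℂ, (F.map (Polynomial.evalRingHom x)).eval y = 0 →
      MvPolynomial.eval ![x, y] Q ≠ 0 →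
      (Sum.elim ![x, y] ![MvPolynomial.eval ![x, y] R / MvPolynomial.eval ![x, y] Q, Complex.exp y] :
        Fin 2 ⊕ Fin 2 → ℂ) ∈ S) :
    UnprojectedDense S := by
  classical
  by_cases hlong : ∃ j, j < F.natDegree ∧ F.leadingCoeff.natDegree < (F.coeff j).natDegree
  · obtain ⟨k, M, Φ, hk, hM, hΦan, hΦ0, hplace⟩ :=
      exists_place_atInfinity_of_longRow F hFirr (by omega) hlong
    obtain ⟨Φr, hΦr⟩ := exists_rowsEquiv
    have hndvdR : ¬ F ∣ Φr R := by
      refine not_dvd_of_exists_eval_ne_zero F ?_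
      obtain ⟨x, y, hxy, hne⟩ := hR
      exact ⟨x, y, hxy, by rw [← hΦr]; exact hne⟩
    have hndvdQ : ¬ F ∣ Φr Q := by
      refine not_dvd_of_exists_eval_ne_zero F ?_
      obtain ⟨x, y, hxy, hne⟩ := hQ
      exact ⟨x, y, hxy, by rw [← hΦr]; exact hne⟩
    obtain ⟨ψR, LR, hψRan, hψR0, hfR⟩ :=
      exists_rows_place_normalForm F hFirr (by omega) (Φr R) hndvdR hk M hΦan hplace
    obtain ⟨ψQ, LQ, hψQan, hψQ0, hfQ⟩ :=
      exists_rows_place_normalForm F hFirr (by omega) (Φr Q) hndvdQ hk M hΦan hplace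
    have hψQne : ∀ᶠ s in 𝓝 (0 : ℂ), ψQ s ≠ 0 := hψQan.continuousAt.eventually_ne hψQ0
    refine unprojectedDense_branch_of_algebraicCurve F hS hdim hFirr
      (planeCurve_not_contains_line F hFirr hn) halg hk hM hΦan hΦ0 hplace (LR - LQ) (hψRan.div hψQan hψQ0) (div_ne_zero hψR0 hψQ0) ?_
    filter_upwards [hplace, hfR, hfQ, self_mem_nhdsWithin, nhdsWithin_le_nhds hψQne] with s hs hsR hsQ
      (hs0 : s ≠ 0) hψQs
    have hQne : MvPolynomial.eval ![(s ^ k)⁻¹, Φ s * (s ^ M)⁻¹] Q ≠ 0 := by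
      rw [hΦr, hsQ]
      exact mul_ne_zero hψQs (zpow_ne_zero _ hs0)
    have hmem := hsub _ _ hs hQne
    have hval : MvPolynomial.eval ![(s ^ k)⁻¹, Φ s * (s ^ M)⁻¹] R /
        MvPolynomial.eval ![(s ^ k)⁻¹, Φ s * (s ^ M)⁻¹] Q = ψR s / ψQ s * s ^ (LR - LQ) := by
      rw [hΦr, hΦr, hsR, hsQ, zpow_sub₀ hs0]
      field_simp
    rw [hval] at hmem
    exact hmem
  · -- bounded place from the top row at the level of the leading row (file LXVII(b))
    push Not at hlong
    set N := F.leadingCoeff.natDegree with hNdef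
    have hN : ∀ j, (F.coeff j).natDegree ≤ N := by
      intro j
      by_cases hj : j < F.natDegree
      · exact hlong j hj
      · by_cases hj' : j = F.natDegree
        · rw [hj']
          exact le_rfl
        · rw [Polynomial.coeff_eq_zero_of_natDegree_lt (by omega), Polynomial.natDegree_zero]
          exact Nat.zero_le _
    set T : ℂ[X] := ∑ j ∈ Finset.range (F.natDegree + 1), Polynomial.monomial j ((F.coeff j).coeff N)
      with hTdef
    have hT : ∀ j, T.coeff j = (F.coeff j).coeff N := by
      intro j
      rw [hTdef, Polynomial.finsetSum_coeff]
      simp only [Polynomial.coeff_monomial, Finset.sum_ite_eq', Finset.mem_range]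
      split_ifs with h
      · rfl
      · rw [Polynomial.coeff_eq_zero_of_natDegree_lt (p := F) (by omega), Polynomial.coeff_zero]
    have hTn : T.coeff F.natDegree ≠ 0 := by
      rw [hT]
      exact Polynomial.leadingCoeff_ne_zero.2 (Polynomial.leadingCoeff_ne_zero.2 hFirr.ne_zero)
    have hT0 : T ≠ 0 := fun h => hTn (by rw [h, Polynomial.coeff_zero])
    have hTdeg : T.degree ≠ 0 := by
      intro h0
      have hle := Polynomial.le_natDegree_of_ne_zero hTn
      rw [Polynomial.degree_eq_natDegree hT0] at h0
      have h00 : T.natDegree = 0 := by exact_mod_cast h0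
      omega
    obtain ⟨θ, hθ⟩ := IsAlgClosed.exists_root T hTdeg
    obtain ⟨k, Φ, hk, hΦan, -, hplace⟩ :=
      exists_fibreCycle_puiseux F hFirr (by omega) N hN T hT hT0 hθ
    exact unprojectedDense_planeCurve_rationalFibre_boundedPlace F hFirr hn hk hΦan hplace R Q hR hQ hS
      hdim hsub

end AlgebraicCurves

end Summit.Schanuel.Schanuel.Theorems

end
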